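import Literature.NumberTheory.EllipticCurves.CorpuzLei2025.PlusEtaAnalyticInvariantsCongruentCurves
import Literature.NumberTheory.EllipticCurves.SelmerCorankControlRatProofs
import Literature.NumberTheory.EllipticCurves.AdditiveReductionSemistableModelProofs
import Summits.BirchSwinnertonDyer.Rank1Residual.X2.EulerFactorInvariants
import Summits.BirchSwinnertonDyer.BirchSwinnertonDyer.Theorems.ThetaPartnerAtTwoSignedTransportAtTwoOrientedEulerFactor
import Literature.NumberTheory.EllipticCurves.CorpuzLei2025.PlusEtaImprimitiveCongruence
import HarnessLib

/-!
# Route `QuadraticBranchSignedControl` (rung K8, cell `bsd-potss`), crux stmt-BirchSwinnertonDyer-19606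
# `PlusEtaMainConjectureNonsurj`: Part LII — THE ANALYTIC λ-TRANSFER FACT (Corpuz–Lei Thm. 5.3 at `η`, v8's cite input `h53`) IS A
# KERNEL COROLLARY OF THE CONGRUENCE OF THE Σ₀-IMPRIMITIVE BRANCH FUNCTIONS (Corpuz–Lei Thm. 4.5 at `i = (p−1)/2`, `r = 1`):
# `L·∏_{Σ₀}𝒫_ℓ^ι(W) ≡ u·L′·∏_{Σ₀}𝒫_ℓ^ι(W′) (mod p)` ⟹ (`μ(L) = 0 ⟹ μ(L′) = 0 ∧ ord(L̄) + Σδ(W) = ord(L̄′) + Σδ(W′)`),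
# with Greenberg–Vatsal's Prop. (2.4) for the `ι`-ORIENTED Euler-factor elements at odd `p` proved on the way

WHY. Skeleton v8 of the crux (k8eta-c2 g33's candidate, pen SUMMON key (585)(B)) lists among its nine cite-level inputs
`h53 = CorpuzLei2025.thm53_etaPlusAnalyticMuLambda_transfer_of_torsionIso` — the paper's COROLLARY 5.3 (the invariants), typed in tree
currency with a dictionary (local terms = `GreenbergVatsal2000.delta` of the η-TWIST `W`, flag `CL25-eta-plus-dictionary`). The paper's proof of
5.3 is two lines from its central Theorem 4.5 (the congruence of the Σ₀-imprimitive signed `p`-adic `L`-functions,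
`L_{p,Σ₀}(f,♮,ω^i,X) := L_p(f,♮,ω^i,X) × ∏_{v∈Σ₀} 𝓔_v(f,ω^i)`, `𝓔_v(f,ω^i)` = the image of `𝒫_v(f, v⁻¹γ_v)` under `ω^i`) and «[EPW]: `𝓔_v`
has trivial `μ`-invariant». THIS FILE RUNS THOSE TWO LINES IN THE KERNEL, in the tree's currency: at `i = (p−1)/2` the factor `𝓔_v(f, η)` is
`P_v(f, η(ℓ)ℓ⁻¹γ_ℓ) = P_v(W, ℓ⁻¹γ_ℓ)` (`P_{V⊗η,ℓ}(X) = P_{V,ℓ}(η(ℓ)X)`, `η` unramified at `ℓ ≠ p`), i.e. Greenberg–Vatsal's element of the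
TWIST `W`, in the tree's (Mazur–Tate–Teitelbaum) orientation of the branch functions the `ι`-oriented one `eulerFactorElementInv W p v =
P_ℓ(W, ℓ⁻¹(1+T)^{−f_ℓ})` (module note «ORIENTATION of `T`» of `GreenbergVatsal2000/NonPrimitivePAdicLFunction`: a tree-normalised `L` — value at
`χ(γ) − 1` ↔ the `χ̄`-twisted value, which is how `Kobayashi2003.IsQuadraticBranchPlusLFunction` pins `L_p⁺(V, η, X)` — is depleted by `𝒫^ι`).
So:
* §9 (fact-free) Greenberg–Vatsal Prop. (2.4) for the `ι`-ORIENTED elements at odd `p` (the cell `b2b-bsdres` proved the `γ_ℓ`-oriented case,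
  `X2.EulerFactorInvariants`; `p = 2` oriented: `ThetaPartnerAtTwo…OrientedEulerFactor`, whose any-`p` reduction lemma
  `SignedTransportAtTwo.map_toZMod_eulerFactorElementInv` — `𝒫_ℓ^ι mod p = P̃_ℓ(ℓ̃⁻¹·((1+T)^{−f_ℓ} mod p))` — is REUSED),
  **`ord_T(𝒫_ℓ^ι mod p) = δ_W^{(ℓ)}`** (`v_p(−f_ℓ) = v_p(f_ℓ)`), unit content, and the product versions over `Σ₀ ∌ (p)`.
* §10 (fact-free algebra in `𝔽_p⟦T⟧`) `hasUnitContent_and_order_eq_of_congr_mul`: from `L·E − u·L′·E′ ∈ pΛ` with `u ∈ ℤ_pˣ`, `μ(E) = μ(E′) = 0`: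
  `μ(L) = 0 ⟹ μ(L′) = 0 ∧ ord(L̄) + ord(Ē) = ord(L̄′) + ord(Ē′)`; `order_map_residue_eq_order_map_toZMod` (the two reductions of the tree).
* §11 **`thm53_of_imprimitiveCongruence`**: the named fact `h53` FOLLOWS from the congruence statement `h45` (Corpuz–Lei Thm. 4.5 at
  `i = (p−1)/2`, plus sign, `r = 1`, spelled out in tree currency as a hypothesis — same binder frame as `h53`, conclusion
  `∃ u, IsUnit u ∧ ∃ D, L·∏𝒫^ι(W) = C u·(L′·∏𝒫^ι(W′)) + C p·D`), and BY NAME **`thm53_of_thm45`** from the Literature named fact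
  `CorpuzLei2025.thm45_etaPlusImprimitive_congruence_of_torsionIso` (this seat, p778190, reviewed ACCEPT) — so a planner may cite 4.5 and
  DERIVE 5.3. The local terms come out as `delta W p w` of the TWISTS — a kernel confirmation of the dictionary of `h53`.

HONEST FRAMING (cell `bsd-potss`, run/shared/lean/pub/bsd-potss/; FULL-BSD rank ≤ 1 programme, HUMAN RULING D-0036/D-0074): THEOREMS ONLY —
no definition, no new named fact IN THIS FILE (the congruence is a displayed hypothesis), no `sorry`, axioms standard. §9–§10 are unconditional
algebra; §11 is CONDITIONAL on the displayed congruence (a claim of an accepted-forthcoming paper, arXiv:2508.09733v2 «to appear in Math. Z.»;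
flag `CL25-forthcoming`; orientation flag `CL25-45-orientation`: the tree-oriented depletion factor is `𝒫^ι`, by the GV module note — were the
opposite orientation meant, §11 goes through verbatim with `eulerFactorProduct`, `X2.EulerFactorInvariants.order_map_toZMod_eulerFactorProduct`).
Nothing about (A), analytic `μ`, (C1⁺_η) or `BSD(W, p)` is asserted; crux 19606 and the route stay OPEN; nothing is booked. Seat
`bsd-potss-k8eta-c2` g34 (prover), `--supports stmt-BirchSwinnertonDyer-19606`.

References: [CorpuzLei2025] §4 (𝓔_v, (eq:Lp-imp)), Thm. 4.5, Thm. 5.3 and its proof (arXiv:2508.09733v2 pp. 13, 15); [GreenbergVatsal2000] §1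
pp. 8–9 (displays (8)–(9)), §2 Prop. (2.4) (p. 22) and its Remark; [EmertonPollackWeston2006] §3 (μ(𝓔_v) = 0); [MazurTateTeitelbaum1986Invent]
§I.13 (orientation of `T`); [Kobayashi2003] Thm. 3.2, (3.4)/(3.6) (p. 7).
-/

set_option autoImplicit false
set_option linter.dupNamespace false

noncomputable section

open scoped Classical

open scoped MatrixGroups ModularForm

open Polynomial NumberField IsDedekindDomain WeierstrassCurve Field CongruenceSubgroup
open Literature.NumberTheory.EllipticCurves
open Literature.NumberTheory.EllipticCurves.ModularForms
open Literature.NumberTheory.GaloisRepresentations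
open Literature.NumberTheory.EllipticCurves.Kobayashi2003
open Literature.NumberTheory.EllipticCurves.GreenbergVatsal2000
open Summit.BirchSwinnertonDyer.Rank1Residual.X2.EulerFactorAlgebra
open Summit.BirchSwinnertonDyer.Rank1Residual.X2.EulerFactorInvariants

namespace Summit.BirchSwinnertonDyer.BirchSwinnertonDyer.Theorems

namespace EtaImprimitiveTransfer

/-! ## §9 Greenberg–Vatsal Prop. (2.4) for the ι-oriented Euler-factor elements `𝒫_ℓ^ι = P_ℓ(W, ℓ⁻¹(1+T)^{−f_ℓ})`, odd `p` -/

section Oriented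

variable (W : WeierstrassCurve ℚ) {p : ℕ} [hp : Fact p.Prime] (v : HeightOneSpectrum (𝓞 ℚ))

/-- **Greenberg–Vatsal Prop. (2.4) for the ι-ORIENTED element: `ord_T(𝒫_ℓ^ι mod p) = s_ℓ · d_ℓ = δ_W^{(ℓ)}`** (`= delta W p v`) at every
prime `ℓ ≠ p`, `p` odd — the proof of `X2.EulerFactorInvariants.order_map_toZMod_eulerFactorElement` with `f_ℓ ↦ −f_ℓ` (`v_p(−f_ℓ) = v_p(f_ℓ)`,
so `ord_T((1+T)^{−f_ℓ} − 1 mod p) = p^{v_p(f_ℓ)} = s_ℓ` as well). [cite: GreenbergVatsal2000, §2 Prop. (2.4) (p. 22) and its Remark] -/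
theorem order_map_toZMod_eulerFactorElementInv (hp2 : p ≠ 2) (hℓ : Rat.HeightOneSpectrum.natGenerator v ≠ p) :
    (PowerSeries.map (PadicInt.toZMod (p := p)) (eulerFactorElementInv W p v)).order = delta W p v := by
  obtain ⟨hcop, h1⟩ := coprime_natGenerator v hℓ
  set ℓ := Rat.HeightOneSpectrum.natGenerator v with hℓdef
  set a : ZMod p := ((ℓ : ZMod p))⁻¹ with ha
  set G := PowerSeries.map (PadicInt.toZMod (p := p))
    (PowerSeries.binomialSeries ℤ_[p] (-(frobeniusExponent p (ℓ : ℤ_[p])))) with hG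
  have hsplit : PowerSeries.C a * G = PowerSeries.C a + PowerSeries.C a * (G - 1) := by ring
  have hG0 : PowerSeries.constantCoeff G = 1 := by
    rw [hG, ← PowerSeries.coeff_zero_eq_constantCoeff_apply, PowerSeries.coeff_map,
      PowerSeries.binomialSeries_coeff, Ring.choose_zero_right, one_smul, map_one]
  have hε0 : PowerSeries.constantCoeff (PowerSeries.C a * (G - 1)) = 0 := by
    rw [map_mul, map_sub, hG0, map_one, sub_self, mul_zero]
  have hℓ0 : (ℓ : ZMod p) ≠ 0 := by
    rw [Ne, ZMod.natCast_eq_zero_iff]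
    exact (Nat.Prime.coprime_iff_not_dvd hp.out).mp hcop
  have ha0 : a ≠ 0 := by
    rw [ha]
    exact inv_ne_zero hℓ0
  have hf0 : -(frobeniusExponent p (ℓ : ℤ_[p])) ≠ 0 := neg_ne_zero.mpr (frobeniusExponent_natCast_ne_zero hcop h1)
  have hεord : (PowerSeries.C a * (G - 1)).order = sFactor p ℓ := by
    rw [PowerSeries.order_mul, PowerSeries.order_zero_of_unit
      ((PowerSeries.isUnit_iff_constantCoeff).mpr (by rwa [PowerSeries.constantCoeff_C, isUnit_iff_ne_zero])),
      zero_add, hG, order_map_binomialSeries_sub_one p hf0, padicInt_valuation_neg,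
      ← pow_valuation_frobeniusExponent_eq_sFactor hp2 hcop h1, Nat.cast_pow]
  rw [SignedTransportAtTwo.map_toZMod_eulerFactorElementInv W v hℓ, ← hG, hsplit,
    order_aeval_C_add (eulerFactorModP_ne_zero W v) a hε0, hεord, delta_eq, dMultiplicity, ← ha,
    Nat.cast_mul, mul_comm]

/-- `μ(𝒫_ℓ^ι) = 0`: the ι-oriented element has unit content (`ℓ ≠ p`, `p` odd). [cite: GreenbergVatsal2000, §1 p. 9 and §2 Prop. (2.4)] -/
theorem hasUnitContent_eulerFactorElementInv (hp2 : p ≠ 2) (hℓ : Rat.HeightOneSpectrum.natGenerator v ≠ p) :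
    HasUnitContent (eulerFactorElementInv W p v) := by
  rw [hasUnitContent_iff_map_toZMod_ne_zero]
  intro h
  have := order_map_toZMod_eulerFactorElementInv W v hp2 hℓ
  rw [h, PowerSeries.order_zero] at this
  exact ENat.top_ne_coe _ this

variable (S₀ : Finset (HeightOneSpectrum (𝓞 ℚ)))

/-- **`ord_T(∏_{ℓ∈Σ₀} 𝒫_ℓ^ι mod p) = Σ_{ℓ∈Σ₀} δ_W^{(ℓ)}`** and the oriented product has unit content, for a finite set `Σ₀` of places none of
which lies above `p` (`p` odd). [cite: GreenbergVatsal2000, §1 p. 9 (display (9)) and §2 Prop. (2.4)] -/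
theorem order_map_toZMod_eulerFactorProductInv (hp2 : p ≠ 2) (hS : ∀ v ∈ S₀, Rat.HeightOneSpectrum.natGenerator v ≠ p) :
    HasUnitContent (eulerFactorProductInv W p S₀) ∧
      (PowerSeries.map (PadicInt.toZMod (p := p)) (eulerFactorProductInv W p S₀)).order =
        ((∑ v ∈ S₀, delta W p v : ℕ) : ℕ∞) := by
  induction S₀ using Finset.induction_on with
  | empty =>
    refine ⟨⟨0, ?_⟩, ?_⟩
    · rw [eulerFactorProductInv_empty, PowerSeries.coeff_zero_eq_constantCoeff, map_one]
      exact isUnit_one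
    · rw [eulerFactorProductInv_empty, map_one, PowerSeries.order_one, Finset.sum_empty, Nat.cast_zero]
  | insert v S hv ih =>
    obtain ⟨ihu, iho⟩ := ih (fun w hw => hS w (Finset.mem_insert_of_mem hw))
    have hvp := hS v (Finset.mem_insert_self v S)
    refine ⟨?_, ?_⟩
    · rw [eulerFactorProductInv_insert W p hv, hasUnitContent_mul_iff]
      exact ⟨hasUnitContent_eulerFactorElementInv W v hp2 hvp, ihu⟩
    · rw [eulerFactorProductInv_insert W p hv, map_mul, PowerSeries.order_mul, iho,
        order_map_toZMod_eulerFactorElementInv W v hp2 hvp, Finset.sum_insert hv, Nat.cast_add]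

end Oriented

/-! ## §10 The algebra of the two-line proof of Thm. 5.3 in `𝔽_p⟦T⟧` -/

section Algebra

variable {p : ℕ} [hp : Fact p.Prime]

/-- The two reductions of `Λ = ℤ_p⟦T⟧` used in the tree — `PadicInt.toZMod` (to `𝔽_p⟦T⟧`) and `IsLocalRing.residue` (to the residue
field) — give the same `T`-order (`toZMod = residueField ∘ residue`, `PadicInt.toZMod_eq_residueField_comp_residue`). [folklore] -/
theorem order_map_residue_eq_order_map_toZMod (F : IwasawaAlgebra p) :
    (PowerSeries.map (IsLocalRing.residue ℤ_[p]) F).order = (PowerSeries.map (PadicInt.toZMod (p := p)) F).order := by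
  rw [PadicInt.toZMod_eq_residueField_comp_residue, PowerSeries.map_comp, RingHom.comp_apply]
  set G := PowerSeries.map (IsLocalRing.residue ℤ_[p]) F with hG
  -- `residueField : ResidueField ℤ_p ≃ 𝔽_p` is injective, so the order is unchanged (cf. `PowerSeries.le_order_map`)
  refine le_antisymm (PowerSeries.le_order_map _) ?_
  by_cases hG0 : G = 0
  · simp only [hG0, map_zero, PowerSeries.order_zero, le_refl]
  · have hn : G.order = ((G.order).toNat : ℕ∞) := (ENat.coe_toNat (PowerSeries.order_eq_top.not.mpr hG0)).symm
    rw [hn]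
    apply PowerSeries.order_le
    rw [PowerSeries.coeff_map]
    intro h
    exact PowerSeries.coeff_order hG0 ((PadicInt.residueField (p := p)).injective
      (by rw [map_zero]; exact h))

/-- **The two lines of the proof of Corpuz–Lei Thm. 5.3, as algebra in `Λ`.** If `L·E − u·L′·E′ ∈ pΛ` with `u ∈ ℤ_pˣ` (here: `= C u·(L′E′) + C p·D`)
and `E`, `E′` have unit content, then `μ(L) = 0` implies `μ(L′) = 0` and `ord_T(L̄) + ord_T(Ē) = ord_T(L̄′) + ord_T(Ē′)` (reduce mod `p`;
`𝔽_p⟦T⟧` is a domain; `ord` is additive). [cite: CorpuzLei2025, proof of Thm. 5.3 (arXiv:2508.09733v2 p. 15)] [cite: GreenbergVatsal2000, §1 p. 9 (display (9))] -/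
theorem hasUnitContent_and_order_eq_of_congr_mul {L L' E E' D : IwasawaAlgebra p} {u : ℤ_[p]} (hu : IsUnit u)
    (hE : HasUnitContent E) (hE' : HasUnitContent E')
    (hcong : L * E = PowerSeries.C u * (L' * E') + PowerSeries.C (p : ℤ_[p]) * D) (hL : HasUnitContent L) :
    HasUnitContent L' ∧
      (PowerSeries.map (PadicInt.toZMod (p := p)) L).order + (PowerSeries.map (PadicInt.toZMod (p := p)) E).order =
        (PowerSeries.map (PadicInt.toZMod (p := p)) L').order + (PowerSeries.map (PadicInt.toZMod (p := p)) E').order := by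
  have hred : PowerSeries.map (PadicInt.toZMod (p := p)) L * PowerSeries.map (PadicInt.toZMod (p := p)) E =
      PowerSeries.C (PadicInt.toZMod (p := p) u) *
        (PowerSeries.map (PadicInt.toZMod (p := p)) L' * PowerSeries.map (PadicInt.toZMod (p := p)) E') := by
    have h := congrArg (PowerSeries.map (PadicInt.toZMod (p := p))) hcong
    rw [map_mul, map_add, map_mul, map_mul, map_mul, PowerSeries.map_C, PowerSeries.map_C, map_natCast,
      ZMod.natCast_self, map_zero, zero_mul, add_zero] at h
    exact h
  have hub : PadicInt.toZMod (p := p) u ≠ 0 := (hu.map _).ne_zero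
  have hLb := (hasUnitContent_iff_map_toZMod_ne_zero _).mp hL
  have hEb := (hasUnitContent_iff_map_toZMod_ne_zero _).mp hE
  have hEb' := (hasUnitContent_iff_map_toZMod_ne_zero _).mp hE'
  have hLb' : PowerSeries.map (PadicInt.toZMod (p := p)) L' ≠ 0 := by
    intro h0
    rw [h0, zero_mul, mul_zero] at hred
    exact (mul_ne_zero hLb hEb) hred
  refine ⟨(hasUnitContent_iff_map_toZMod_ne_zero _).mpr hLb', ?_⟩
  have hCu : (PowerSeries.C (PadicInt.toZMod (p := p) u)).order = 0 :=
    PowerSeries.order_zero_of_unit ((PowerSeries.isUnit_iff_constantCoeff (φ := PowerSeries.C _)).mpr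
      (by rw [PowerSeries.constantCoeff_C]; exact isUnit_iff_ne_zero.mpr hub))
  have hord := congrArg PowerSeries.order hred
  rw [PowerSeries.order_mul, PowerSeries.order_mul, PowerSeries.order_mul, hCu, zero_add] at hord
  exact hord

end Algebra

/-! ## §11 Corpuz–Lei Thm. 5.3 at `η` (the named fact `h53`) from the congruence of the Σ₀-imprimitive branch functions -/

section Transfer

/-- **`h53` FROM `h45`: Corpuz–Lei Thm. 5.3 at `i = (p−1)/2` (the tree's named fact
`CorpuzLei2025.thm53_etaPlusAnalyticMuLambda_transfer_of_torsionIso`, VERBATIM as conclusion) follows from the CONGRUENCE of the Σ₀-imprimitive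
plus `η`-branch functions (Corpuz–Lei Thm. 4.5 at `i = (p−1)/2`, plus sign, `r = 1`, spelled out in tree currency as the hypothesis `h45` — same
binder frame as `h53`; conclusion: `∃ u ∈ ℤ_pˣ`, `∃ D`, `L·∏_{Σ₀}𝒫_ℓ^ι(W) = C u·(L′·∏_{Σ₀}𝒫_ℓ^ι(W′)) + C p·D`).** Proof = the paper's: `μ(∏𝒫^ι) = 0`
and `ord(∏𝒫^ι(W) mod p) = Σ_{Σ₀} delta W p w` (§9: `(p) ∉ Σ₀` because `V`, `V′` are good at `p`), then §10. The local terms that come out are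
those of the TWISTS `W, W′` — the dictionary of `h53` confirmed in the kernel. CONDITIONAL on `h45` (a claim of an accepted-forthcoming
paper; orientation flag `CL25-45-orientation`); nothing booked. [claim: CorpuzLei2025, status: under-review]
[cite: CorpuzLei2025, Thm. 4.5, §4 (eq:Lp-imp), Thm. 5.3 and its proof (arXiv:2508.09733v2 pp. 13, 15)]
[cite: GreenbergVatsal2000, §1 p. 9 (display (9)), §2 Prop. (2.4) (p. 22) and its Remark] [cite: EmertonPollackWeston2006, §3 (3.4)–(3.5)] -/
theorem thm53_of_imprimitiveCongruence
    (h45 : ∀ (V V' : WeierstrassCurve ℚ) [V.IsElliptic] [V.IsGloballyMinimal] [V'.IsElliptic]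
        [V'.IsGloballyMinimal] (p : ℕ) [Fact p.Prime],
      p ≠ 2 →
      V.HasGoodReductionAtPrime p → V.frobeniusTrace p = 0 →
      V'.HasGoodReductionAtPrime p → V'.frobeniusTrace p = 0 →
      (∃ e : geomTorsion V (p : ℤ) ≃+ geomTorsion V' (p : ℤ),
        ∀ (σ : Field.absoluteGaloisGroup ℚ) (P : geomTorsion V (p : ℤ)), e (σ • P) = σ • e P) →
      ∀ (W W' : WeierstrassCurve ℚ) [W.IsElliptic] [W.IsGloballyMinimal] [W'.IsElliptic]
          [W'.IsGloballyMinimal] (C C' : VariableChange ℚ),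
        C • W.quadraticTwist ((-1) ^ (p / 2) * p) = V →
        C' • W'.quadraticTwist ((-1) ^ (p / 2) * p) = V' →
      ∀ (S₀ : Finset (HeightOneSpectrum (𝓞 ℚ))),
        (∀ w : HeightOneSpectrum (𝓞 ℚ), w ∈ S₀ ↔ (¬ V.HasGoodReductionAt w ∨ ¬ V'.HasGoodReductionAt w)) →
      ∀ {N : ℕ} [NeZero N] {f : CuspForm (Gamma0 N) 2} {N' : ℕ} [NeZero N'] {f' : CuspForm (Gamma0 N') 2},
        IsNewformOf V f → IsNewformOf V' f' →
      ∀ (ϖ ϖ' : ℚ),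
        (if Even (p / 2) then (ϖ : ℝ) * V.realPeriodRat = plusPeriod f
          else (ϖ : ℝ) * V.imaginaryPeriodRat = minusPeriod f) →
        (if Even (p / 2) then (ϖ' : ℝ) * V'.realPeriodRat = plusPeriod f'
          else (ϖ' : ℝ) * V'.imaginaryPeriodRat = minusPeriod f') →
      ∀ (L L' : IwasawaAlgebra p),
        IsQuadraticBranchPlusLFunction f p ϖ L → IsQuadraticBranchPlusLFunction f' p ϖ' L' →
        L ≠ 0 → L' ≠ 0 →
        ∃ u : ℤ_[p], IsUnit u ∧ ∃ D : IwasawaAlgebra p,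
          L * eulerFactorProductInv W p S₀ =
            PowerSeries.C u * (L' * eulerFactorProductInv W' p S₀) + PowerSeries.C (p : ℤ_[p]) * D) :
    CorpuzLei2025.thm53_etaPlusAnalyticMuLambda_transfer_of_torsionIso := by
  intro V V' _ _ _ _ p _ hp2 hgood hap hgood' hap' he W W' _ _ _ _ C C' hCV hCV' S₀ hS₀ N _ f N' _ f' hf hf' ϖ ϖ' hϖ hϖ'
    L L' hL hL' hL0 hL'0 hμ
  obtain ⟨u, hu, D, hcong⟩ :=
    h45 V V' p hp2 hgood hap hgood' hap' he W W' C C' hCV hCV' S₀ hS₀ hf hf' ϖ ϖ' hϖ hϖ' L L' hL hL' hL0 hL'0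
  -- `(p) ∉ Σ₀`: both curves are good at `p`
  have hS : ∀ w ∈ S₀, Rat.HeightOneSpectrum.natGenerator w ≠ p := by
    intro w hw
    apply natGenerator_ne_of_natCast_not_mem
    intro hpw
    rcases (hS₀ w).mp hw with h | h
    · exact h (WeierstrassCurve.hasGoodReductionAt_of_hasGoodReductionAtPrime V w hpw hgood)
    · exact h (WeierstrassCurve.hasGoodReductionAt_of_hasGoodReductionAtPrime V' w hpw hgood')
  obtain ⟨hEμ, hEord⟩ := order_map_toZMod_eulerFactorProductInv W S₀ hp2 hS
  obtain ⟨hE'μ, hE'ord⟩ := order_map_toZMod_eulerFactorProductInv W' S₀ hp2 hS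
  obtain ⟨hμ', hord⟩ := hasUnitContent_and_order_eq_of_congr_mul hu hEμ hE'μ hcong hμ
  refine ⟨hμ', ?_⟩
  -- read the `ℕ∞` identity `ord L̄ + Σδ(W) = ord L̄′ + Σδ(W′)` in `ℕ` (both orders finite since `μ = 0`)
  rw [hEord, hE'ord] at hord
  have hfin : (PowerSeries.map (PadicInt.toZMod (p := p)) L).order ≠ ⊤ :=
    PowerSeries.order_eq_top.not.mpr ((hasUnitContent_iff_map_toZMod_ne_zero _).mp hμ)
  have hfin' : (PowerSeries.map (PadicInt.toZMod (p := p)) L').order ≠ ⊤ :=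
    PowerSeries.order_eq_top.not.mpr ((hasUnitContent_iff_map_toZMod_ne_zero _).mp hμ')
  rw [order_map_residue_eq_order_map_toZMod, order_map_residue_eq_order_map_toZMod]
  rw [← ENat.coe_toNat hfin, ← ENat.coe_toNat hfin'] at hord
  exact_mod_cast hord

/-- **`h53` from `h45` BY NAME**: the tree's named fact for Corpuz–Lei Thm. 5.3 at `η`
(`CorpuzLei2025.thm53_etaPlusAnalyticMuLambda_transfer_of_torsionIso`, p775217) follows from the tree's named fact for Corpuz–Lei
Thm. 4.5 at `η` (`CorpuzLei2025.thm45_etaPlusImprimitive_congruence_of_torsionIso`, p778190) — one step of the paper's own proof, now in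
the kernel; a planner may list `h45` in `stub_etaMC_publishedInputs` and derive `h53`. CONDITIONAL (fact in hypothesis position);
nothing booked. [claim: CorpuzLei2025, status: under-review] [cite: CorpuzLei2025, Thm. 4.5, Thm. 5.3 and its proof (arXiv:2508.09733v2 pp. 13, 15)]
[cite: GreenbergVatsal2000, §2 Prop. (2.4) (p. 22)] -/
theorem thm53_of_thm45 (h45 : CorpuzLei2025.thm45_etaPlusImprimitive_congruence_of_torsionIso) :
    CorpuzLei2025.thm53_etaPlusAnalyticMuLambda_transfer_of_torsionIso :=
  thm53_of_imprimitiveCongruence h45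

end Transfer

end EtaImprimitiveTransfer

end Summit.BirchSwinnertonDyer.BirchSwinnertonDyer.Theorems

end
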